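import Summits.KontsevichZagierPeriods.Zeta5Search.Barrier.ConeGammaTopClassBoxA38
import Summits.KontsevichZagierPeriods.Zeta5Search.Barrier.ConeGammaTopClassBoxA44
import Summits.KontsevichZagierPeriods.Zeta5Search.Barrier.ConeGammaTopClassBoxA47
import Summits.KontsevichZagierPeriods.Zeta5Search.Barrier.ConeGammaTopClassBoxA50
import Summits.KontsevichZagierPeriods.Zeta5Search.Barrier.ConeGammaTopClassBoxA53
import Summits.KontsevichZagierPeriods.Zeta5Search.Barrier.ConeGammaTopClassBoxA59
import Summits.KontsevichZagierPeriods.Zeta5Search.Barrier.ConeGammaFarSliceBoxesRec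
import Summits.KontsevichZagierPeriods.Zeta5Search.Barrier.ConeGammaSkeletonCover

/-!
# ζ(5) search — BARRIER: BZ'S RECORD FAMILY — SEVEN KERNEL BOXES CHAINED ALONG THE ARITHMETIC-PROGRESSION RIDGE

HONEST FRAMING (cell `pub-zeta5`): systematic search; no irrationality claim unless kernel-certified. MODEL objects under Brown–Zudilin's
(28)+(30) accounting ([BZ22] = arXiv:2210.03391; (28) observed, not proved): the rate `gamma` of `ConeGammaRates`. WHAT THIS FILE SAYS: the seven
kernel boxes of half-width 1/100 centred at the arithmetic-progression classes (t_j = t₁ + (j−1)d) 38;6,…,18 · 41;7,…,19 (BZ's record t_rec, the tree's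
`FarSlice.gamma_le_slice_rec_100`) · 44;8,…,20 · 47;9,…,21 · 50;10,…,22 · 53;11,…,23 · 59;13,…,25 (cert-2 g42 `TopBox.gamma_le_box_*`) — BOX-A classes nos.
11, 2, 5, 12, 6, 9, 29 of the lane's census list «γ_28 ≥ 0.86» (×1 Arb, DATA, not kernel) — have consecutive centres < 2/100 apart in sup-norm (0.0128,
0.0111, 0.0097, 0.0085, 0.0075, 0.0128), so by exact linear arithmetic over ℚ their UNION `apUnion` contains the sup-norm tube of radius 1/1250 around the
POLYGONAL LINE through the seven centres (t₁ from 3/19 to 13/59, d from 1/19 down to 2/59; t₄ = t₁ + 3d ≈ 0.32 along it); hence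
**`gamma a ≤ 9381/10⁴`** for every REGULAR direction of the closed positive box within 1/1250 (height one) of that line. WHAT IT DOES NOT SAY: a COARSE
ceiling on a tube around a 1-D polygonal skeleton of the AP flat's hot patch — nothing about the AP flat off the tube, the cone's supremum (C2 OPEN), the
witness sentence, S-E (CONJECTURED), (TD_A) or `ζ(5)`; no number or sentence of record moves; class-60 words untouched; records in print UNMOVED. Theory
seat cert-2 g42 (item «THE FLAT'S OUTER ROWS AND BOX-A'S TOP CLASSES IN KERNEL BOXES» + sequel, INBOX plans l.9845 / l.9855; `SkelCover.mem_box_of_near`,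
`LemmaFWinBox.loBox_rec_100` and `FarSlice.gamma_le_slice_rec_100` used BY NAME).
-/

open Set
open Literature.Analysis.ValidatedNumerics.NumericsMP

noncomputable section

namespace Summit.KontsevichZagierPeriods.Zeta5Search.Barrier.ConeGamma

namespace TopBox

open LemmaFBox (box)
open SkelCover (mem_box_of_near)

/-- **The AP chain**: the union of the seven kernel boxes (`LemmaFBox.box D lo hi`, D = 2s₀·100) centred at 38;6,…,18, t_rec = 41;7,…,19, 44;8,…,20, 47;9,…,21,
50;10,…,22, 53;11,…,23, 59;13,…,25. -/
def apUnion : Set (Fin 8 → ℝ) :=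
  box 3800 loBox_a38_100 hiBox_a38_100 ∪
  box 4100 LemmaFWinBox.loBox_rec_100 LemmaFWinBox.hiBox_rec_100 ∪
  box 4400 loBox_a44_100 hiBox_a44_100 ∪
  box 4700 loBox_a47_100 hiBox_a47_100 ∪
  box 5000 loBox_a50_100 hiBox_a50_100 ∪
  box 5300 loBox_a53_100 hiBox_a53_100 ∪
  box 5900 loBox_a59_100 hiBox_a59_100

/-- The box around (38; 6,8,10,12,14,16,18) is part of the AP chain. -/
theorem mem_ap_a38 {t : Fin 8 → ℝ} (h : t ∈ box 3800 loBox_a38_100 hiBox_a38_100) : t ∈ apUnion := by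
  unfold apUnion; exact Or.inl (Or.inl (Or.inl (Or.inl (Or.inl (Or.inl (h))))))

/-- The box around t_rec (41; 7,…,19) is part of the AP chain. -/
theorem mem_ap_rec {t : Fin 8 → ℝ} (h : t ∈ box 4100 LemmaFWinBox.loBox_rec_100 LemmaFWinBox.hiBox_rec_100) : t ∈ apUnion := by
  unfold apUnion; exact Or.inl (Or.inl (Or.inl (Or.inl (Or.inl (Or.inr h)))))

/-- The box around (44; 8,10,12,14,16,18,20) is part of the AP chain. -/
theorem mem_ap_a44 {t : Fin 8 → ℝ} (h : t ∈ box 4400 loBox_a44_100 hiBox_a44_100) : t ∈ apUnion := by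
  unfold apUnion; exact Or.inl (Or.inl (Or.inl (Or.inl (Or.inr h))))

/-- The box around (47; 9,11,13,15,17,19,21) is part of the AP chain. -/
theorem mem_ap_a47 {t : Fin 8 → ℝ} (h : t ∈ box 4700 loBox_a47_100 hiBox_a47_100) : t ∈ apUnion := by
  unfold apUnion; exact Or.inl (Or.inl (Or.inl (Or.inr h)))

/-- The box around (50; 10,12,14,16,18,20,22) is part of the AP chain. -/
theorem mem_ap_a50 {t : Fin 8 → ℝ} (h : t ∈ box 5000 loBox_a50_100 hiBox_a50_100) : t ∈ apUnion := by
  unfold apUnion; exact Or.inl (Or.inl (Or.inr h))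

/-- The box around (53; 11,13,15,17,19,21,23) is part of the AP chain. -/
theorem mem_ap_a53 {t : Fin 8 → ℝ} (h : t ∈ box 5300 loBox_a53_100 hiBox_a53_100) : t ∈ apUnion := by
  unfold apUnion; exact Or.inl (Or.inr h)

/-- The box around (59; 13,15,17,19,21,23,25) is part of the AP chain. -/
theorem mem_ap_a59 {t : Fin 8 → ℝ} (h : t ∈ box 5900 loBox_a59_100 hiBox_a59_100) : t ∈ apUnion := by
  unfold apUnion; exact Or.inr h

/-- **`γ(a) ≤ 9381/10⁴` on the AP chain** — the maximum of the seven box bounds (38: 0.9275, t_rec: 0.9297 (g40), 44: 0.9341, 47: 0.9367, 50: 0.9381, 53: 0.9338, 59: 0.9364), BY NAME.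
MODEL `gamma` under BZ (28)+(30); COARSE; nothing about the cone's supremum (C2 OPEN). -/
theorem gamma_le_apchain {a : Dir} (ha : BZBox a) (hreg : Regular a)
    (h : (fun i => sParam a i / sParam a 0) ∈ apUnion) : gamma a ≤ (9381 : ℝ) / 10000 := by
  unfold apUnion at h
  rcases h with (((((h | h) | h) | h) | h) | h) | h
  · exact (gamma_le_box_a38_100 ha (fun j => h j.succ) hreg).trans (by norm_num)
  · exact (FarSlice.gamma_le_slice_rec_100 ha (fun j => h j.succ) hreg).trans (by norm_num)
  · exact (gamma_le_box_a44_100 ha (fun j => h j.succ) hreg).trans (by norm_num)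
  · exact (gamma_le_box_a47_100 ha (fun j => h j.succ) hreg).trans (by norm_num)
  · exact (gamma_le_box_a50_100 ha (fun j => h j.succ) hreg).trans (by norm_num)
  · exact (gamma_le_box_a53_100 ha (fun j => h j.succ) hreg).trans (by norm_num)
  · exact (gamma_le_box_a59_100 ha (fun j => h j.succ) hreg).trans (by norm_num)

/-- The seven AP centres at height one, in chain order: 38;6,…,18 · 41;7,…,19 · 44;8,…,20 · 47;9,…,21 · 50;10,…,22 · 53;11,…,23 · 59;13,…,25. -/
def apVert : Fin 7 → (Fin 8 → ℝ) :=
  ![![1, 3 / 19, 4 / 19, 5 / 19, 6 / 19, 7 / 19, 8 / 19, 9 / 19],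
    ![1, 7 / 41, 9 / 41, 11 / 41, 13 / 41, 15 / 41, 17 / 41, 19 / 41],
    ![1, 2 / 11, 5 / 22, 3 / 11, 7 / 22, 4 / 11, 9 / 22, 5 / 11],
    ![1, 9 / 47, 11 / 47, 13 / 47, 15 / 47, 17 / 47, 19 / 47, 21 / 47],
    ![1, 1 / 5, 6 / 25, 7 / 25, 8 / 25, 9 / 25, 2 / 5, 11 / 25],
    ![1, 11 / 53, 13 / 53, 15 / 53, 17 / 53, 19 / 53, 21 / 53, 23 / 53],
    ![1, 13 / 59, 15 / 59, 17 / 59, 19 / 59, 21 / 59, 23 / 59, 25 / 59]]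

/-- The k-th segment of the polygonal line through the seven centres: `s ↦ (1 − s)·apVert k + s·apVert (k+1)`. -/
def apSeg (k : Fin 6) (s : ℝ) : Fin 8 → ℝ := fun i => (1 - s) * apVert k.castSucc i + s * apVert k.succ i

/-- Segment 0 (a38 → rec): every height-one point within 1/1250 of it lies in `apUnion` (s ≤ 1/2 → the first box, s ≥ 1/2 → the second; exact). -/
theorem mem_ap_seg0 {t : Fin 8 → ℝ} {s : ℝ} (hs : 0 ≤ s ∧ s ≤ 1) (ht0 : t 0 = 1)
    (ht : ∀ i : Fin 8, |t i - apSeg 0 s i| ≤ 1 / 1250) : t ∈ apUnion := by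
  obtain ⟨hs0, hs1⟩ := hs
  by_cases hh : s ≤ 1 / 2
  · refine mem_ap_a38 (mem_box_of_near (by decide) ht0 ht fun j => ?_)
    fin_cases j <;> simp [apSeg, apVert, loBox_a38_100, hiBox_a38_100] <;> constructor <;> linarith
  rw [not_le] at hh
  refine mem_ap_rec (mem_box_of_near (by decide) ht0 ht fun j => ?_)
  fin_cases j <;> simp [apSeg, apVert, LemmaFWinBox.loBox_rec_100, LemmaFWinBox.hiBox_rec_100] <;> constructor <;> linarith

/-- Segment 1 (rec → a44): every height-one point within 1/1250 of it lies in `apUnion` (s ≤ 1/2 → the first box, s ≥ 1/2 → the second; exact). -/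
theorem mem_ap_seg1 {t : Fin 8 → ℝ} {s : ℝ} (hs : 0 ≤ s ∧ s ≤ 1) (ht0 : t 0 = 1)
    (ht : ∀ i : Fin 8, |t i - apSeg 1 s i| ≤ 1 / 1250) : t ∈ apUnion := by
  obtain ⟨hs0, hs1⟩ := hs
  by_cases hh : s ≤ 1 / 2
  · refine mem_ap_rec (mem_box_of_near (by decide) ht0 ht fun j => ?_)
    fin_cases j <;> simp [apSeg, apVert, LemmaFWinBox.loBox_rec_100, LemmaFWinBox.hiBox_rec_100] <;> constructor <;> linarith
  rw [not_le] at hh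
  refine mem_ap_a44 (mem_box_of_near (by decide) ht0 ht fun j => ?_)
  fin_cases j <;> simp [apSeg, apVert, loBox_a44_100, hiBox_a44_100] <;> constructor <;> linarith

/-- Segment 2 (a44 → a47): every height-one point within 1/1250 of it lies in `apUnion` (s ≤ 1/2 → the first box, s ≥ 1/2 → the second; exact). -/
theorem mem_ap_seg2 {t : Fin 8 → ℝ} {s : ℝ} (hs : 0 ≤ s ∧ s ≤ 1) (ht0 : t 0 = 1)
    (ht : ∀ i : Fin 8, |t i - apSeg 2 s i| ≤ 1 / 1250) : t ∈ apUnion := by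
  obtain ⟨hs0, hs1⟩ := hs
  by_cases hh : s ≤ 1 / 2
  · refine mem_ap_a44 (mem_box_of_near (by decide) ht0 ht fun j => ?_)
    fin_cases j <;> simp [apSeg, apVert, loBox_a44_100, hiBox_a44_100] <;> constructor <;> linarith
  rw [not_le] at hh
  refine mem_ap_a47 (mem_box_of_near (by decide) ht0 ht fun j => ?_)
  fin_cases j <;> simp [apSeg, apVert, loBox_a47_100, hiBox_a47_100] <;> constructor <;> linarith

/-- Segment 3 (a47 → a50): every height-one point within 1/1250 of it lies in `apUnion` (s ≤ 1/2 → the first box, s ≥ 1/2 → the second; exact). -/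
theorem mem_ap_seg3 {t : Fin 8 → ℝ} {s : ℝ} (hs : 0 ≤ s ∧ s ≤ 1) (ht0 : t 0 = 1)
    (ht : ∀ i : Fin 8, |t i - apSeg 3 s i| ≤ 1 / 1250) : t ∈ apUnion := by
  obtain ⟨hs0, hs1⟩ := hs
  by_cases hh : s ≤ 1 / 2
  · refine mem_ap_a47 (mem_box_of_near (by decide) ht0 ht fun j => ?_)
    fin_cases j <;> simp [apSeg, apVert, loBox_a47_100, hiBox_a47_100] <;> constructor <;> linarith
  rw [not_le] at hh
  refine mem_ap_a50 (mem_box_of_near (by decide) ht0 ht fun j => ?_)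
  fin_cases j <;> simp [apSeg, apVert, loBox_a50_100, hiBox_a50_100] <;> constructor <;> linarith

/-- Segment 4 (a50 → a53): every height-one point within 1/1250 of it lies in `apUnion` (s ≤ 1/2 → the first box, s ≥ 1/2 → the second; exact). -/
theorem mem_ap_seg4 {t : Fin 8 → ℝ} {s : ℝ} (hs : 0 ≤ s ∧ s ≤ 1) (ht0 : t 0 = 1)
    (ht : ∀ i : Fin 8, |t i - apSeg 4 s i| ≤ 1 / 1250) : t ∈ apUnion := by
  obtain ⟨hs0, hs1⟩ := hs
  by_cases hh : s ≤ 1 / 2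
  · refine mem_ap_a50 (mem_box_of_near (by decide) ht0 ht fun j => ?_)
    fin_cases j <;> simp [apSeg, apVert, loBox_a50_100, hiBox_a50_100] <;> constructor <;> linarith
  rw [not_le] at hh
  refine mem_ap_a53 (mem_box_of_near (by decide) ht0 ht fun j => ?_)
  fin_cases j <;> simp [apSeg, apVert, loBox_a53_100, hiBox_a53_100] <;> constructor <;> linarith

/-- Segment 5 (a53 → a59): every height-one point within 1/1250 of it lies in `apUnion` (s ≤ 1/2 → the first box, s ≥ 1/2 → the second; exact). -/
theorem mem_ap_seg5 {t : Fin 8 → ℝ} {s : ℝ} (hs : 0 ≤ s ∧ s ≤ 1) (ht0 : t 0 = 1)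
    (ht : ∀ i : Fin 8, |t i - apSeg 5 s i| ≤ 1 / 1250) : t ∈ apUnion := by
  obtain ⟨hs0, hs1⟩ := hs
  by_cases hh : s ≤ 1 / 2
  · refine mem_ap_a53 (mem_box_of_near (by decide) ht0 ht fun j => ?_)
    fin_cases j <;> simp [apSeg, apVert, loBox_a53_100, hiBox_a53_100] <;> constructor <;> linarith
  rw [not_le] at hh
  refine mem_ap_a59 (mem_box_of_near (by decide) ht0 ht fun j => ?_)
  fin_cases j <;> simp [apSeg, apVert, loBox_a59_100, hiBox_a59_100] <;> constructor <;> linarith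

/-- **The AP chain contains the 1/1250-tube around the whole polygonal line** through the seven centres (six segments). -/
theorem mem_apUnion_of_near_seg (k : Fin 6) {t : Fin 8 → ℝ} {s : ℝ} (hs : 0 ≤ s ∧ s ≤ 1) (ht0 : t 0 = 1)
    (ht : ∀ i : Fin 8, |t i - apSeg k s i| ≤ 1 / 1250) : t ∈ apUnion := by
  fin_cases k
  · exact mem_ap_seg0 hs ht0 ht
  · exact mem_ap_seg1 hs ht0 ht
  · exact mem_ap_seg2 hs ht0 ht
  · exact mem_ap_seg3 hs ht0 ht
  · exact mem_ap_seg4 hs ht0 ht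
  · exact mem_ap_seg5 hs ht0 ht

/-- **`γ(a) ≤ 9381/10⁴` for every REGULAR direction within sup-distance 1/1250 (height one) of the polygonal line through the seven AP centres**
(38;6,…,18 → t_rec → 44;8,…,20 → 47;9,…,21 → 50;10,…,22 → 53;11,…,23 → 59;13,…,25). MODEL `gamma` under BZ (28)+(30); a COARSE kernel ceiling on a tube
around a 1-D skeleton of the AP flat's hot patch; nothing about the flat off the tube, the cone's supremum (C2 OPEN) or the sharp certificates of record. -/
theorem gamma_le_near_apchain {a : Dir} (ha : BZBox a) (hreg : Regular a) (k : Fin 6) {s : ℝ} (hs : 0 ≤ s ∧ s ≤ 1)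
    (ht : ∀ i : Fin 8, |sParam a i / sParam a 0 - apSeg k s i| ≤ 1 / 1250) : gamma a ≤ (9381 : ℝ) / 10000 :=
  gamma_le_apchain ha hreg (mem_apUnion_of_near_seg k hs (by simp [ha.1.ne']) ht)

end TopBox

end Summit.KontsevichZagierPeriods.Zeta5Search.Barrier.ConeGamma

end
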